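import Summits.Langlands.Langlands.Theses.TameTypeSwitch

/-!
# Route TameTypeSwitch — Assembly

The assembly item (stmt-Langlands-18278) of route `TameTypeSwitch` for the Langlands summit:
`TameTypedWitness → TypedWitnessFLLifting → SectorComplement → Langlands`.

No mathematical content lives here; it is the logical glue of the route:

* `gappedWeightPA_of_tameTypedWitness_of_typedWitnessFLLifting`: the door `TameTypedWitness`
  (over a finite Galois CM extension `K'/K`, linearly disjoint from `K^av`, with `ℓ` unramified in
  `K'`, a residual representation `τ'` of `r|Γ_K'` with the transported hypotheses and a typed
  weight-0 witness `π`, `r₀`) followed by the engine `TypedWitnessFLLifting` (applied over `F := K'`,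
  CM branch, to `ρ := r|Γ_K'`, `τ'`, `π`, `r₀`) gives the route target `GappedWeightPA`
  (the gap clause of the target is not even used);
* `tameTypeSwitch_assembly_proof`: `SectorComplement := GappedWeightPA → Langlands` finishes.
-/

set_option linter.dupNamespace false -- project-wide option (lakefile weak.linter.dupNamespace); `Summit.Langlands.Langlands` is the mandated namespace

namespace Summit.Langlands.Langlands.Theorems

open Summit.Langlands.Langlands.Theses.TameTypeSwitch in
/-- **Door + engine ⇒ target** for route TameTypeSwitch: `TameTypedWitness → TypedWitnessFLLifting →
GappedWeightPA`. Given the data and hypotheses of `GappedWeightPA` (a CM field `K`, `K^av/K` finite,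
`n ≥ 2`, a prime `ℓ > n²` with `2B+2 < ℓ` unramified in `K`, `ι`, a framed `r : Γ_K → GL_n(ℚ̄_ℓ)`
a.e. unramified, crystalline above `ℓ` with regular labelled Hodge–Tate weights in `[0,B]`, and a
residual representation `τ` that is absolutely irreducible, decomposed generic, enormous on
`Γ_K(ζ_ℓ)` with a scalar element off it), `TameTypedWitness` produces a finite Galois CM `K'/K`,
linearly disjoint from `K^av`, with `ℓ` unramified in `K'`, a level-compactness datum `hcpt'`, a
residual representation `τ'` of `r|Γ_K'` with the transported hypotheses, and a typed weight-0
witness (`π`, `r₀`); `TypedWitnessFLLifting` over `F := K'` (CM branch) applied to `ρ := r|Γ_K'`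
returns a regular algebraic cuspidal `Π`, Satake–Frobenius compatible with `r|Γ_K'` and unramified
above `ℓ` — exactly the conclusion of `GappedWeightPA`. Pure logic (the gap clause is discarded).
[folklore] -/
theorem gappedWeightPA_of_tameTypedWitness_of_typedWitnessFLLifting
    (hW : TameTypedWitness) (hL : TypedWitnessFLLifting) : GappedWeightPA := by
  intro K _ _ hCM Kav _ _ hfd n B hn ℓ _ hℓ hB hunr _k ι r τ hae hcrys _hgap hres hirr hdg _H hirrH
    henorm hscalar
  obtain ⟨K', iF, iN, iA, hK'⟩ :=
    hW K hCM Kav hfd n B hn ℓ hℓ hB hunr ι r τ hae hcrys hres hirr hdg hirrH henorm hscalar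
  obtain ⟨hGal, hCM', hdisj, hunr', hcpt', τ', π, r₀, hae', hcrys', hres', hirr', hdg', hirrH',
    henorm', hscalar', hw0, hcompat, hres₀, h𝔫⟩ := hK'
  obtain ⟨Pi, hreg, hcompatPi, hunrPi⟩ :=
    hL K' (Or.inr hCM') n B hcpt' ℓ hℓ hB hunr' ι (r.restrictField K') τ' π r₀ hae' hcrys' hres'
      hirr' hdg' hirrH' henorm' hscalar' hw0 hcompat hres₀ h𝔫
  exact ⟨K', iF, iN, iA, hGal, hCM', hdisj, hunr', hcpt', Pi, hreg, hcompatPi, hunrPi⟩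

/-- **Assembly of route TameTypeSwitch** (settles stmt-Langlands-18278).
`TameTypedWitness → TypedWitnessFLLifting → SectorComplement → Langlands`: the typed weight-0
witness door, the typed-witness Fontaine–Laffaille lifting engine and the complement of the gapped
Fontaine–Laffaille potential-automorphy sector imply the summit statement `Langlands` of
`Summits/Langlands/Statement.lean`. Proof: unfold `Assembly`; `SectorComplement` is
`GappedWeightPA → Langlands`, and `GappedWeightPA` is
`gappedWeightPA_of_tameTypedWitness_of_typedWitnessFLLifting`. [folklore] -/
theorem tameTypeSwitch_assembly_proof :
    Summit.Langlands.Langlands.Theses.TameTypeSwitch.Assembly := by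
  unfold Summit.Langlands.Langlands.Theses.TameTypeSwitch.Assembly
  intro hW hL hJ
  exact hJ (gappedWeightPA_of_tameTypedWitness_of_typedWitnessFLLifting hW hL)

end Summit.Langlands.Langlands.Theorems
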